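import Mathlib
import Summits.PneNP.PneNP.Theorems.ConvexRankGatesConvexGateBlindPoolMeasure

/-!
# PneNP / ConvexRankGates — `ConvexGateBlind`: pair marginals of the pool measure (exactly affine in the re-centred pattern)

Helpers (`--supports stmt-PneNP-10680`), COLUMN-SPACE line (prover seat 2, session 19); fourth brick of the unconditional
linear ℓ₁-bound. MAIN RESULT (`poolE_pair`): for the pool measure with `r` pools of size `n ≥ 4` inside `U` (`n·r ≤ u = #U`)
and `x ≠ y ∈ U`,

  `E_r^U[x ∈ Q ∧ y ∈ Q] = α_r(u) + β_r(u) · rc_U F(x,y)`,  `α_r(u) = 2r(2r−1)/(u(u−1))`,  `β_r(u) = 2rη·c(u,n)/(u(u−1))`.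

So the pair marginals are EXACTLY affine in the re-centred pattern `rc_U F`, with an `F`-free constant term. Mechanism of
the induction step: `[x,y ∈ Q' ∪ ab] = [x∈ab][y∈ab] + [x∈ab][y∈Q'] + [x∈Q'][y∈ab] + [x,y∈Q']`; the first term is the
same-pool term `2ν(P,x,y)` — affine in `rc_P F`, and superset averaging over the pools through `x,y` makes its average affine
in `rc_U F`; the two cross terms are `F`-FREE because the vertex marginals of the pair weights and of the inner measure are
exactly uniform; the last term is the induction hypothesis inside `U ∖ P`, brought back to `rc_U F` by superset averaging
over pool complements and the cocycle identity. [new]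
-/

set_option linter.dupNamespace false

namespace Summit.PneNP.PneNP.Theorems

open Finset

noncomputable section

variable {m : ℕ}

/-- The `F`-free part of the pair marginal: `α_r(u) = 2r(2r−1)/(u(u−1))`. [new] -/
def poolAlpha (r u : ℕ) : ℝ := 2 * (r : ℝ) * (2 * (r : ℝ) - 1) / ((u : ℝ) * ((u : ℝ) - 1))

/-- The coefficient of `rc_U F` in the pair marginal: `β_r(u) = 2rη·c(u,n)/(u(u−1))`. [new] -/
def poolBeta (η : ℝ) (n r u : ℕ) : ℝ := 2 * (r : ℝ) * η * poolCoef u n / ((u : ℝ) * ((u : ℝ) - 1))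

variable (η : ℝ) (n : ℕ) (F : Fin m → Fin m → ℝ)

/-- **Positivity of the pair weights** for `0 ≤ F ≤ 1`, `0 ≤ η ≤ 1/3`, `#P = n ≥ 4`. [new] -/
theorem poolNu_nonneg (hF0 : ∀ a b, 0 ≤ F a b) (hF1 : ∀ a b, F a b ≤ 1) (hη0 : 0 ≤ η) (hη : η ≤ 1 / 3)
    {P : Finset (Fin m)} (hP : P.card = n) (hn : 4 ≤ n) {a b : Fin m} (ha : a ∈ P) (hb : b ∈ P) :
    0 ≤ poolNu η n F P a b := by
  unfold poolNu
  have h := neg_three_le_poolRc P F hF0 hF1 (by omega) ha hb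
  have hnum : 0 ≤ 1 + η * poolRc P F a b := by nlinarith
  have hn' : (4 : ℝ) ≤ n := by exact_mod_cast hn
  exact div_nonneg hnum (mul_nonneg (by linarith) (by linarith))

/-! ## Indicator bookkeeping -/

/-- `[x ∈ Q ∪ {a,b}] = [x = a ∨ x = b] + [x ∈ Q]` when `a, b ∉ Q`. [new] -/
theorem ind_mem_insert_insert {a b x : Fin m} {Q : Finset (Fin m)} (haQ : a ∉ Q) (hbQ : b ∉ Q) :
    (if x ∈ insert a (insert b Q) then (1 : ℝ) else 0) =
      (if x = a ∨ x = b then (1 : ℝ) else 0) + (if x ∈ Q then 1 else 0) := by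
  by_cases hxa : x = a
  · subst hxa; simp [haQ]
  · by_cases hxb : x = b
    · subst hxb; simp [hbQ]
    · by_cases hxQ : x ∈ Q
      · simp [hxa, hxb, hxQ]
      · simp [hxa, hxb, hxQ]

/-- `[x ∈ S ∧ y ∈ S] = [x ∈ S]·[y ∈ S]`. [folklore] -/
theorem ind_and_eq_mul (p q : Prop) [Decidable p] [Decidable q] :
    (if p ∧ q then (1 : ℝ) else 0) = (if p then (1 : ℝ) else 0) * (if q then 1 else 0) := by
  by_cases hp : p <;> by_cases hq : q <;> simp [hp, hq]

/-- **The four-term expansion** of the pair indicator of `Q ∪ {a,b}` (`a, b ∉ Q`). [new] -/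
theorem ind_pair_insert_insert {a b x y : Fin m} {Q : Finset (Fin m)} (haQ : a ∉ Q) (hbQ : b ∉ Q) :
    (if x ∈ insert a (insert b Q) ∧ y ∈ insert a (insert b Q) then (1 : ℝ) else 0) =
      (if x = a ∨ x = b then (1 : ℝ) else 0) * (if y = a ∨ y = b then (1 : ℝ) else 0) +
      ((if x = a ∨ x = b then (1 : ℝ) else 0) * (if y ∈ Q then 1 else 0) +
      ((if y = a ∨ y = b then (1 : ℝ) else 0) * (if x ∈ Q then 1 else 0) +
      (if x ∈ Q ∧ y ∈ Q then 1 else 0))) := by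
  rw [ind_and_eq_mul, ind_mem_insert_insert haQ hbQ, ind_mem_insert_insert haQ hbQ, ind_and_eq_mul]
  ring

/-- **Double sums against the pair indicator:** only `(a,b) = (x,y), (y,x)` survive. [new] -/
theorem sum_sum_erase_pairInd (P : Finset (Fin m)) (f : Fin m → Fin m → ℝ) {x y : Fin m} (hxy : x ≠ y) :
    ∑ a ∈ P, ∑ b ∈ P.erase a, f a b * ((if x = a ∨ x = b then (1 : ℝ) else 0) * (if y = a ∨ y = b then (1 : ℝ) else 0)) =
      if x ∈ P ∧ y ∈ P then f x y + f y x else 0 := by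
  classical
  set g : Fin m → ℝ := fun a => ∑ b ∈ P.erase a,
    f a b * ((if x = a ∨ x = b then (1 : ℝ) else 0) * (if y = a ∨ y = b then (1 : ℝ) else 0)) with hg
  have hgx : g x = if y ∈ P then f x y else 0 := by
    rw [hg]
    simp only [true_or, if_true, one_mul, hxy.symm, false_or]
    rw [Finset.sum_mul_boole]
    simp [Finset.mem_erase, hxy.symm]
  have hgy : g y = if x ∈ P then f y x else 0 := by
    rw [hg]
    simp only [true_or, if_true, mul_one, hxy, false_or]
    rw [Finset.sum_mul_boole]
    simp [Finset.mem_erase, hxy]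
  have hg0 : ∀ a ∈ P, a ≠ x → a ≠ y → g a = 0 := by
    intro a _ hax hay
    rw [hg]
    refine Finset.sum_eq_zero fun b _ => ?_
    by_cases hxb : x = b
    · have hyb : ¬ (y = a ∨ y = b) := by
        rw [not_or]; exact ⟨Ne.symm hay, fun h => hxy (hxb.trans h.symm)⟩
      rw [if_neg hyb]; ring
    · have hxab : ¬ (x = a ∨ x = b) := not_or.2 ⟨Ne.symm hax, hxb⟩
      rw [if_neg hxab]; ring
  have hsplit : ∀ a ∈ P, g a = (if a = x then g x else 0) + (if a = y then g y else 0) := by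
    intro a ha
    by_cases hax : a = x
    · subst hax; simp [hxy]
    · by_cases hay : a = y
      · subst hay; simp [hax]
      · rw [if_neg hax, if_neg hay, hg0 a ha hax hay]; ring
  show ∑ a ∈ P, g a = _
  rw [Finset.sum_congr rfl hsplit, Finset.sum_add_distrib, Finset.sum_ite_eq', Finset.sum_ite_eq', hgx, hgy]
  by_cases hx : x ∈ P <;> by_cases hy : y ∈ P <;> simp [hx, hy]

/-- The pair weights against the pair indicator: `[x,y ∈ P]·2ν(P,x,y)`. [new] -/
theorem sum_poolNu_pair (hF : ∀ a b, F a b = F b a) (P : Finset (Fin m)) {x y : Fin m} (hxy : x ≠ y) :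
    ∑ a ∈ P, ∑ b ∈ P.erase a, poolNu η n F P a b *
        ((if x = a ∨ x = b then (1 : ℝ) else 0) * (if y = a ∨ y = b then (1 : ℝ) else 0)) =
      if x ∈ P ∧ y ∈ P then 2 * poolNu η n F P x y else 0 := by
  rw [sum_sum_erase_pairInd P _ hxy, poolNu_symm η n F hF P y x]
  split_ifs <;> ring

/-- The pair weights against a single vertex indicator: `[x ∈ P]·2/n`. [new] -/
theorem sum_poolNu_vertex' (hF : ∀ a b, F a b = F b a) {P : Finset (Fin m)} (hP : P.card = n) (hn : 3 ≤ n) (x : Fin m) :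
    ∑ a ∈ P, ∑ b ∈ P.erase a, poolNu η n F P a b * (if x = a ∨ x = b then (1 : ℝ) else 0) =
      if x ∈ P then 2 / (n : ℝ) else 0 := by
  by_cases hx : x ∈ P
  · rw [if_pos hx]; exact sum_poolNu_vertex η n F hF hP hn hx
  · rw [if_neg hx]
    refine Finset.sum_eq_zero fun a ha => Finset.sum_eq_zero fun b hb => ?_
    have hxa : x ≠ a := fun h => hx (h ▸ ha)
    have hxb : x ≠ b := fun h => hx (h ▸ (Finset.mem_erase.1 hb).2)
    rw [if_neg (not_or.2 ⟨hxa, hxb⟩), mul_zero]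

/-! ## The pair marginal -/

/-- **Induction step of the pair marginal.** Assume the pair-marginal formula for `r` pools (in every ambient set). Then it
holds for `r + 1` pools. [new] -/
theorem poolE_pair_step (hF : ∀ a b, F a b = F b a) (hn : 4 ≤ n) {x y : Fin m} (hxy : x ≠ y) (r : ℕ)
    (ih : ∀ U' : Finset (Fin m), n * r ≤ U'.card →
      poolE η n F r U' (fun Q => if x ∈ Q ∧ y ∈ Q then (1 : ℝ) else 0) =
        if x ∈ U' ∧ y ∈ U' then poolAlpha r U'.card + poolBeta η n r U'.card * poolRc U' F x y else 0)
    (U : Finset (Fin m)) (hU : n * (r + 1) ≤ U.card) :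
    poolE η n F (r + 1) U (fun Q => if x ∈ Q ∧ y ∈ Q then (1 : ℝ) else 0) =
      if x ∈ U ∧ y ∈ U then poolAlpha (r + 1) U.card + poolBeta η n (r + 1) U.card * poolRc U F x y else 0 := by
  classical
  have hn3 : 3 ≤ n := by omega
  have hnU : n ≤ U.card := le_trans (by nlinarith) hU
  rw [poolE_succ]
  -- abbreviations for the inner values at a pool `P`
  set vm : Finset (Fin m) → Fin m → ℝ := fun P z =>
    if z ∈ U \ P then 2 * (r : ℝ) / ((U \ P).card : ℝ) else 0 with hvm
  set pm : Finset (Fin m) → ℝ := fun P =>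
    if x ∈ U \ P ∧ y ∈ U \ P then poolAlpha r (U \ P).card + poolBeta η n r (U \ P).card * poolRc (U \ P) F x y
    else 0 with hpm
  -- STEP 1: the inner expectation
  have hinner : ∀ P ∈ U.powersetCard n, ∀ a ∈ P, ∀ b ∈ P.erase a,
      poolE η n F r (U \ P) (fun Q => if x ∈ insert a (insert b Q) ∧ y ∈ insert a (insert b Q) then (1 : ℝ) else 0) =
        (if x = a ∨ x = b then (1 : ℝ) else 0) * (if y = a ∨ y = b then (1 : ℝ) else 0) +
        ((if x = a ∨ x = b then (1 : ℝ) else 0) * vm P y +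
        ((if y = a ∨ y = b then (1 : ℝ) else 0) * vm P x + pm P)) := by
    intro P hP a ha b hb
    rw [Finset.mem_powersetCard] at hP
    have hbP : b ∈ P := (Finset.mem_erase.1 hb).2
    have hcard : n * r ≤ (U \ P).card := by
      rw [Finset.card_sdiff_of_subset hP.1, hP.2]
      have : n * (r + 1) = n * r + n := by ring
      omega
    -- replace the integrand by the four-term expansion (valid on subsets of `U ∖ P`)
    have hcongr := poolE_congr_on η n F r (U \ P)
      (fun Q => if x ∈ insert a (insert b Q) ∧ y ∈ insert a (insert b Q) then (1 : ℝ) else 0)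
      (fun Q => (if x = a ∨ x = b then (1 : ℝ) else 0) * (if y = a ∨ y = b then (1 : ℝ) else 0) * 1 +
        (((if x = a ∨ x = b then (1 : ℝ) else 0) * (if y ∈ Q then 1 else 0)) +
        (((if y = a ∨ y = b then (1 : ℝ) else 0) * (if x ∈ Q then 1 else 0)) +
        (if x ∈ Q ∧ y ∈ Q then 1 else 0))))
      (fun Q hQ _ => by
        have haQ : a ∉ Q := fun h => (Finset.mem_sdiff.1 (hQ h)).2 ha
        have hbQ : b ∉ Q := fun h => (Finset.mem_sdiff.1 (hQ h)).2 hbP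
        rw [ind_pair_insert_insert haQ hbQ, mul_one])
    rw [hcongr, poolE_add, poolE_add, poolE_add, poolE_smul, poolE_smul, poolE_smul, poolE_one η n F hn3 r _ hcard,
      poolE_vertex η n F hF hn3 y r _ hcard, poolE_vertex η n F hF hn3 x r _ hcard, ih _ hcard]
    simp only [hvm, hpm, mul_one]
  -- STEP 2: the pool sums
  have hS : ∀ P ∈ U.powersetCard n,
      ∑ a ∈ P, ∑ b ∈ P.erase a, poolNu η n F P a b *
        poolE η n F r (U \ P) (fun Q => if x ∈ insert a (insert b Q) ∧ y ∈ insert a (insert b Q) then (1 : ℝ) else 0) =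
      (if x ∈ P ∧ y ∈ P then 2 * poolNu η n F P x y else 0) +
        ((if x ∈ P then 2 / (n : ℝ) else 0) * vm P y + ((if y ∈ P then 2 / (n : ℝ) else 0) * vm P x + pm P)) := by
    intro P hP
    have hP' := Finset.mem_powersetCard.1 hP
    rw [Finset.sum_congr rfl (fun a ha => Finset.sum_congr rfl (fun b hb => by rw [hinner P hP a ha b hb]))]
    simp_rw [mul_add, Finset.sum_add_distrib]
    rw [sum_poolNu_pair η n F hF P hxy]
    congr 1
    have h2 : ∑ a ∈ P, ∑ b ∈ P.erase a, poolNu η n F P a b * ((if x = a ∨ x = b then (1 : ℝ) else 0) * vm P y) =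
        (if x ∈ P then 2 / (n : ℝ) else 0) * vm P y := by
      simp_rw [← mul_assoc, ← Finset.sum_mul]
      rw [sum_poolNu_vertex' η n F hF hP'.2 hn3 x]
    have h3 : ∑ a ∈ P, ∑ b ∈ P.erase a, poolNu η n F P a b * ((if y = a ∨ y = b then (1 : ℝ) else 0) * vm P x) =
        (if y ∈ P then 2 / (n : ℝ) else 0) * vm P x := by
      simp_rw [← mul_assoc, ← Finset.sum_mul]
      rw [sum_poolNu_vertex' η n F hF hP'.2 hn3 y]
    have h4 : ∑ a ∈ P, ∑ b ∈ P.erase a, poolNu η n F P a b * pm P = pm P := by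
      simp_rw [← Finset.sum_mul]
      rw [sum_poolNu η n F hP'.2 hn3, one_mul]
    rw [h2, h3, h4]
  rw [Finset.sum_congr rfl hS]
  -- STEP 3: the sums over pools
  by_cases hxyU : x ∈ U ∧ y ∈ U
  swap
  · -- trivial case: a marked vertex lies outside `U`, everything vanishes
    rw [if_neg hxyU]
    have hzero : ∀ P ∈ U.powersetCard n,
        (if x ∈ P ∧ y ∈ P then 2 * poolNu η n F P x y else 0) +
          ((if x ∈ P then 2 / (n : ℝ) else 0) * vm P y + ((if y ∈ P then 2 / (n : ℝ) else 0) * vm P x + pm P)) = 0 := by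
      intro P hP
      have hPU := (Finset.mem_powersetCard.1 hP).1
      rw [hvm, hpm]
      dsimp only
      rcases not_and_or.1 hxyU with hx | hy
      · have hxP : x ∉ P := fun h => hx (hPU h)
        have hxUP : x ∉ U \ P := fun h => hx (Finset.mem_sdiff.1 h).1
        simp [hxP, hxUP]
      · have hyP : y ∉ P := fun h => hy (hPU h)
        have hyUP : y ∉ U \ P := fun h => hy (Finset.mem_sdiff.1 h).1
        simp [hyP, hyUP]
    rw [Finset.sum_congr rfl hzero, Finset.sum_const_zero, mul_zero]
  obtain ⟨hxU, hyU⟩ := hxyU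
  rw [if_pos ⟨hxU, hyU⟩]
  -- notation
  set u : ℕ := U.card with hu
  set C : ℝ := ((u.choose n : ℕ) : ℝ) with hC
  set rcU : ℝ := poolRc U F x y with hrcU
  set cc : ℝ := poolCoef u n with hcc
  set αc : ℝ := poolAlpha r (u - n) with hαc
  set βc : ℝ := poolBeta η n r (u - n) with hβc
  have hn4R : (4 : ℝ) ≤ n := by exact_mod_cast hn
  have hnuR : (n : ℝ) ≤ u := by exact_mod_cast hnU
  have hC0 : C ≠ 0 := by rw [hC]; exact_mod_cast (Nat.choose_pos hnU).ne'
  have hu0 : (u : ℝ) ≠ 0 := by linarith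
  have hu1 : (u : ℝ) - 1 ≠ 0 := by linarith
  have hn0 : (n : ℝ) ≠ 0 := by linarith
  have hn1 : (n : ℝ) - 1 ≠ 0 := by linarith
  have hcast : ((u - n : ℕ) : ℝ) = (u : ℝ) - n := Nat.cast_sub hnU
  -- (a) the same-pool term
  have hTA : ∑ P ∈ U.powersetCard n, (if x ∈ P ∧ y ∈ P then 2 * poolNu η n F P x y else 0) =
      2 / ((n : ℝ) * ((n : ℝ) - 1)) * ((u - 2).choose (n - 2) : ℝ) * (1 + η * cc * rcU) := by
    rw [← Finset.sum_filter]
    have hsummand : ∀ P : Finset (Fin m), 2 * poolNu η n F P x y =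
        2 / ((n : ℝ) * ((n : ℝ) - 1)) + 2 * η / ((n : ℝ) * ((n : ℝ) - 1)) * poolRc P F x y := by
      intro P; unfold poolNu; ring
    rw [Finset.sum_congr rfl (fun P _ => hsummand P), Finset.sum_add_distrib, Finset.sum_const, ← Finset.mul_sum,
      sum_poolRc_pools U F hF hxy hxU hyU hn hnU, card_pools_mem_mem U hxy hxU hyU (by omega), nsmul_eq_mul]
    rw [hcc, hrcU, hu]
    ring
  -- (b), (c) the cross terms
  have hTB : ∑ P ∈ U.powersetCard n, (if x ∈ P then 2 / (n : ℝ) else 0) * vm P y =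
      ((u - 2).choose (n - 1) : ℝ) * (2 / (n : ℝ) * (2 * (r : ℝ) / ((u : ℝ) - n))) := by
    have hval : ∀ P ∈ U.powersetCard n, (if x ∈ P then 2 / (n : ℝ) else 0) * vm P y =
        if x ∈ P ∧ y ∉ P then 2 / (n : ℝ) * (2 * (r : ℝ) / ((u : ℝ) - n)) else 0 := by
      intro P hP
      obtain ⟨hPU, hPc⟩ := Finset.mem_powersetCard.1 hP
      rw [hvm]
      dsimp only
      by_cases hx : x ∈ P
      · by_cases hy : y ∈ P
        · rw [if_pos hx, if_neg (fun h => (Finset.mem_sdiff.1 h).2 hy), if_neg (fun h => h.2 hy), mul_zero]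
        · rw [if_pos hx, if_pos (Finset.mem_sdiff.2 ⟨hyU, hy⟩), if_pos ⟨hx, hy⟩, Finset.card_sdiff_of_subset hPU, hPc,
            ← hu, hcast]
      · rw [if_neg hx, zero_mul, if_neg (fun h => hx h.1)]
    rw [Finset.sum_congr rfl hval, ← Finset.sum_filter, Finset.sum_const, card_pools_mem_not_mem U hxy hxU hyU (by omega) hnU,
      nsmul_eq_mul]
  have hTC : ∑ P ∈ U.powersetCard n, (if y ∈ P then 2 / (n : ℝ) else 0) * vm P x =
      ((u - 2).choose (n - 1) : ℝ) * (2 / (n : ℝ) * (2 * (r : ℝ) / ((u : ℝ) - n))) := by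
    have hval : ∀ P ∈ U.powersetCard n, (if y ∈ P then 2 / (n : ℝ) else 0) * vm P x =
        if y ∈ P ∧ x ∉ P then 2 / (n : ℝ) * (2 * (r : ℝ) / ((u : ℝ) - n)) else 0 := by
      intro P hP
      obtain ⟨hPU, hPc⟩ := Finset.mem_powersetCard.1 hP
      rw [hvm]
      dsimp only
      by_cases hy : y ∈ P
      · by_cases hx : x ∈ P
        · rw [if_pos hy, if_neg (fun h => (Finset.mem_sdiff.1 h).2 hx), if_neg (fun h => h.2 hx), mul_zero]
        · rw [if_pos hy, if_pos (Finset.mem_sdiff.2 ⟨hxU, hx⟩), if_pos ⟨hy, hx⟩, Finset.card_sdiff_of_subset hPU, hPc,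
            ← hu, hcast]
      · rw [if_neg hy, zero_mul, if_neg (fun h => hy h.1)]
    rw [Finset.sum_congr rfl hval, ← Finset.sum_filter, Finset.sum_const,
      card_pools_mem_not_mem U (Ne.symm hxy) hyU hxU (by omega) hnU, nsmul_eq_mul]
  -- (d) the inner pair term
  have hTD : ∑ P ∈ U.powersetCard n, pm P =
      ((u - 2).choose n : ℝ) * αc + βc * ∑ P ∈ (U.powersetCard n).filter (fun P => x ∉ P ∧ y ∉ P), poolRc (U \ P) F x y := by
    have hval : ∀ P ∈ U.powersetCard n, pm P = if x ∉ P ∧ y ∉ P then αc + βc * poolRc (U \ P) F x y else 0 := by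
      intro P hP
      obtain ⟨hPU, hPc⟩ := Finset.mem_powersetCard.1 hP
      rw [hpm]
      dsimp only
      rw [Finset.card_sdiff_of_subset hPU, hPc, ← hu]
      by_cases hx : x ∈ P
      · rw [if_neg (fun h => (Finset.mem_sdiff.1 h.1).2 hx), if_neg (fun h => h.1 hx)]
      · by_cases hy : y ∈ P
        · rw [if_neg (fun h => (Finset.mem_sdiff.1 h.2).2 hy), if_neg (fun h => h.2 hy)]
        · rw [if_pos ⟨Finset.mem_sdiff.2 ⟨hxU, hx⟩, Finset.mem_sdiff.2 ⟨hyU, hy⟩⟩, if_pos ⟨hx, hy⟩]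
    rw [Finset.sum_congr rfl hval, ← Finset.sum_filter, Finset.sum_add_distrib, Finset.sum_const, ← Finset.mul_sum,
      card_pools_not_mem_not_mem U hxy hxU hyU n, nsmul_eq_mul]
  rw [Finset.sum_add_distrib, Finset.sum_add_distrib, Finset.sum_add_distrib, hTA, hTB, hTC, hTD]
  -- binomial closed forms
  have hA2 : ((u - 2).choose (n - 2) : ℝ) = (n : ℝ) * ((n : ℝ) - 1) * C / ((u : ℝ) * ((u : ℝ) - 1)) := by
    rw [eq_div_iff (mul_ne_zero hu0 hu1), hC]
    have := cast_choose_sub_two u n (by omega) hnU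
    linear_combination this
  have hA1 : ((u - 2).choose (n - 1) : ℝ) = (n : ℝ) * ((u : ℝ) - n) * C / ((u : ℝ) * ((u : ℝ) - 1)) := by
    rw [eq_div_iff (mul_ne_zero hu0 hu1), hC]
    have := cast_choose_sub_two' u n (by omega) hnU (by omega)
    linear_combination this
  have hA0 : ((u - 2).choose n : ℝ) = ((u : ℝ) - n) * ((u : ℝ) - n - 1) * C / ((u : ℝ) * ((u : ℝ) - 1)) := by
    rw [eq_div_iff (mul_ne_zero hu0 hu1), hC]
    have := cast_choose_sub_two'' u n hnU (by omega)
    linear_combination this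
  rcases Nat.eq_zero_or_pos r with hr0 | hrpos
  · -- `r = 0`: only the same-pool term survives
    subst hr0
    have hα0 : αc = 0 := by rw [hαc]; unfold poolAlpha; simp
    have hβ0 : βc = 0 := by rw [hβc]; unfold poolBeta; simp
    rw [hA2, hA1, hA0, hα0, hβ0]
    unfold poolAlpha poolBeta
    rw [← hcc]
    push_cast
    field_simp
    ring
  · -- `r ≥ 1`: `u ≥ 2n ≥ n + 4`, complements averaging and the cocycle identity
    have h2n2 : 2 * n ≤ u := by
      have : n * 2 ≤ n * (r + 1) := Nat.mul_le_mul_left n (by omega)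
      omega
    have h2n : n + 4 ≤ u := by omega
    have h2nR : 2 * (n : ℝ) ≤ u := by exact_mod_cast h2n2
    have hun0 : (u : ℝ) - n ≠ 0 := by linarith
    have hun1 : (u : ℝ) - n - 1 ≠ 0 := by linarith
    rw [sum_poolRc_complements U F hF hxy hxU hyU h2n, ← hu, ← hrcU, hA2, hA1, hA0]
    -- the cocycle: `c(u−n,n)·c(u,u−n) = c(u,n)`
    have hcyc : poolCoef ((u : ℝ) - n) n * poolCoef u ((u : ℝ) - n) = cc := by
      rw [hcc]; exact poolCoef_cocycle hn4R (by linarith) (by linarith)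
    have hD : βc * (((u : ℝ) - n) * ((u : ℝ) - n - 1) * C / ((u : ℝ) * ((u : ℝ) - 1)) * poolCoef u ((u : ℝ) - n) * rcU) =
        2 * (r : ℝ) * η * C * cc * rcU / ((u : ℝ) * ((u : ℝ) - 1)) := by
      rw [← hcyc, hβc]
      unfold poolBeta
      rw [hcast]
      field_simp
    have hαc' : αc = 2 * (r : ℝ) * (2 * (r : ℝ) - 1) / (((u : ℝ) - n) * ((u : ℝ) - n - 1)) := by
      rw [hαc]; unfold poolAlpha; rw [hcast]
    rw [hD, hαc']
    unfold poolAlpha poolBeta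
    rw [← hcc]
    push_cast
    field_simp
    ring

/-- **Pair marginals of the pool measure.** For `x ≠ y`, `n ≥ 4`, `n·r ≤ #U`:
`E_r^U[x ∈ Q ∧ y ∈ Q] = α_r(u) + β_r(u)·rc_U F(x,y)` if `x, y ∈ U` (and `0` otherwise) — exactly affine in the
re-centred pattern, with the `F`-free constant `α_r(u) = 2r(2r−1)/(u(u−1))` and slope `β_r(u) = 2rη·c(u,n)/(u(u−1))`. [new] -/
theorem poolE_pair (hF : ∀ a b, F a b = F b a) (hn : 4 ≤ n) {x y : Fin m} (hxy : x ≠ y) (r : ℕ) (U : Finset (Fin m))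
    (hU : n * r ≤ U.card) :
    poolE η n F r U (fun Q => if x ∈ Q ∧ y ∈ Q then (1 : ℝ) else 0) =
      if x ∈ U ∧ y ∈ U then poolAlpha r U.card + poolBeta η n r U.card * poolRc U F x y else 0 := by
  induction r generalizing U with
  | zero =>
    rw [poolE_zero]
    unfold poolAlpha poolBeta
    simp
  | succ r ih => exact poolE_pair_step η n F hF hn hxy r ih U hU

/-- **Pair marginals of the pool measure** (registered form of `poolE_pair`). [new] -/
theorem pool_pair_marginal : ∀ {m : ℕ} (η : ℝ) (n : ℕ) (F : Fin m → Fin m → ℝ), (∀ a b, F a b = F b a) → 4 ≤ n → ∀ {x y : Fin m}, x ≠ y → ∀ (r : ℕ) (U : Finset (Fin m)), n * r ≤ U.card → poolE η n F r U (fun Q => if x ∈ Q ∧ y ∈ Q then (1 : ℝ) else 0) = if x ∈ U ∧ y ∈ U then poolAlpha r U.card + poolBeta η n r U.card * poolRc U F x y else 0 :=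
  fun η n F hF hn _ _ hxy r U hU => poolE_pair η n F hF hn hxy r U hU

end

end Summit.PneNP.PneNP.Theorems
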